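import Mathlib
import Summits.HubbardSuperconductivity.HubbardSuperconductivity.Theorems.LevyLogBootstrapBlock2InfDivXXZFourCheckB

/-!
# Crux `Block2InfDivXXZ` (stmt-HubbardSuperconductivity-15048), `M = 4` slice: kernel facts,
# orbit table (keys of rank `0 ≤ r < 4290`)
-/

set_option linter.dupNamespace false
set_option linter.style.longLine false

namespace Summit.HubbardSuperconductivity.HubbardSuperconductivity.Theorems.LevyLogBootstrap

namespace FourCert

set_option maxRecDepth 100000
/-- `tableCheckRange 0 1430` holds. -/
theorem fact_range0 : tableCheckRange 0 1430 = true := by decide +kernel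
/-- `tableCheckRange 1430 2860` holds. -/
theorem fact_range1 : tableCheckRange 1430 2860 = true := by decide +kernel
/-- `tableCheckRange 2860 4290` holds. -/
theorem fact_range2 : tableCheckRange 2860 4290 = true := by decide +kernel

end FourCert

end Summit.HubbardSuperconductivity.HubbardSuperconductivity.Theorems.LevyLogBootstrap
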